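import Mathlib.FieldTheory.LinearDisjoint
import Literature.NumberTheory.NumberFields.CMFieldCompositum
import HarnessLib

/-!
# The trace over `F` of the totally imaginary elements of a CM field `E` inside a field `K = EF`
# (Moonen–Zarhin 1998, Remarks (2)–(3) on the Type 4 condition `θ ≠ 0`)

Topic `NumberTheory/NumberFields`; THEOREMS ONLY (no definition, no named fact; D-0026 net debt 0).
Sequel of `TotallyRealOrCM.lean` / `CMFieldCompositum.lean` (Shimura §18.2 Lemma (iv): a subfield of a
CM field is totally real or CM).

## The print

B. J. J. Moonen, Yu. G. Zarhin, *Weil classes on abelian varieties*, J. reine angew. Math. **496** (1998)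
83–92 = arXiv:alg-geom/9612017 [MoonenZarhin1998WeilClasses], the section «In practice, the condition
(eq:Type4cond) …» after Criterion (2) (held text `paper:arxiv-alg-geom_9612017`, chunk p0004).  Setting:
`X ∼ Y^m`, `Y` simple of Type 4, `D = End⁰(Y)`, `E = Z(D)` a CM field with maximal totally real subfield
`E₀` and `E₋ = {α ∈ E | ᾱ = -α}`, `F ⊆ End⁰(X)` a subfield, and
`θ : E₋ ↪ End_F(V_X) —Tr_F→ F`.  VERBATIM:

> «(2) Assume `X` is of type 4 with either `d ≥ 2` or `m ≥ 2`. If the map `θ : E₋ ↪ End_F(V_X) → F` is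
> zero, then the intersection `E ∩ F` is a totally real subfield of `E`, i.e., `E ∩ F ⊆ E₀`. In fact, if
> `E ∩ F` is not totally real, then (being a CM-subfield of `E`) it must contain totally imaginary elements
> `0 ≠ α ∈ E₋`, which then obviously have a non-zero trace over `F`.
> (3) Let us show that the converse of (2) holds if either `E` or `F` is Galois over `E ∩ F`. So, we assume
> that `E ∩ F` is totally real and that `E` is Galois over `E ∩ F`. The compositum `EF ⊆ End⁰(X)` is a
> product of fields, say `EF = K₁ × ⋯ × K_t`. Correspondingly, we can decompose `H¹(X,ℚ)` as a direct sum
> `V₁ ⊕ ⋯ ⊕ V_t`. It suffices to show that each of the maps `θᵢ : E₋ ↪ End_F(Vᵢ) → F` is zero. We have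
> `E₋ ↪ Kᵢ ⊂ End_{Kᵢ}(Vᵢ)`, and it follows that for `α ∈ E₋`, `θᵢ(α) = Tr_{Kᵢ/F}(dim_{Kᵢ}(Vᵢ) · α) =
> dim_{Kᵢ}(Vᵢ) · Tr_{Kᵢ/F}(α)`. On the other hand, if either `E` or `F` is Galois over `E ∩ F`, then the
> trace of `α` (considered as an element of `Kᵢ`) over `F` lies in `E ∩ F`, hence
> `Tr_{Kᵢ/F}(α) = [Kᵢ:E]/[F:E∩F] · Tr_{E/E∩F}(α) = 0`.»

## What is proved here (the field theory of (2) and (3))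

Throughout §1–§2, `L ⊆ K` is a finite extension of fields and `E, F` are intermediate fields of `K/L` with
**`E ⊓ F = ⊥` (`E ∩ F = L`) and `E ⊔ F = ⊤` (`K = EF` is the compositum)** — Mathlib's setting for
`IntermediateField.LinearDisjoint`; this is ONE field `Kᵢ = EF` of the print with `E ∩ F` computed INSIDE it.

* §1 (any characteristic) **the trace identity of (3)**: if `E/L` or `F/L` is Galois then `E`, `F` are
  linearly disjoint (Mathlib `IntermediateField.LinearDisjoint.of_inf_eq_bot`), `[K:E] = [F:L]`
  (`finrank_eq_finrank_of_isGalois_left/right` — the print's factor `[Kᵢ:E]/[F:E∩F]` is `1`) and for every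
  `α ∈ E`, **`Tr_{K/F}(α) = Tr_{E/L}(α)`** in `F` (`trace_algebraMap_eq_of_isGalois_left/right`, Mathlib
  `LinearDisjoint.trace_algebraMap`), i.e. the displayed `[F:E∩F] · Tr_{K/F}(α) = [K:E] · Tr_{E/E∩F}(α)`
  (`finrank_smul_trace_algebraMap_eq_of_isGalois_left/right`).
* §2 **the vanishing**: if an `L`-automorphism `σ` of `E` negates `α` then `Tr_{E/L}(α) = 0`
  (`trace_eq_zero_of_algEquiv_apply_eq_neg`; characteristic `≠ 2` in the form `CharZero L`), hence
  `Tr_{K/F}(α) = 0` under §1 (`trace_algebraMap_eq_zero_of_isGalois_left/right`).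
* §3 **the CM dictionary** (Mathlib `NumberField.IsCMField`, `IsCMField.complexConj`): for a CM number field
  `E` over a number field `L`, **`L` is totally real iff the complex conjugation of `E` fixes `L` pointwise**
  (`isTotallyReal_iff_forall_complexConj_algebraMap_eq`; «`E ∩ F` totally real, i.e. `E ∩ F ⊆ E₀`»); an
  embedding of CM fields commutes with the complex conjugations (`algebraMap_complexConj`); and then
  `Tr_{E/L}(α) = 0` for `α ∈ E₋` (`trace_eq_zero_of_complexConj_apply_eq_neg`).
* §4 **Remark (3) for `K = EF` a field** (`t = 1`): `E` CM, `E ∩ F = L` totally real, `E/L` or `F/L`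
  Galois ⟹ `Tr_{K/F}(α) = 0` for every `α ∈ E₋`
  (`trace_algebraMap_eq_zero_of_isCMField_of_isGalois_left/right`).
* §5 **Remark (2)** (no Galois or compositum hypothesis; `L → E → K`, `L → F → K` any towers of number
  fields with `E` CM): if `Tr_{K/F}(α) = 0` for every `α ∈ E₋`, then conjugation fixes `L` pointwise, i.e.
  `L` is totally real (`isTotallyReal_of_forall_trace_algebraMap_eq_zero`) — by the printed argument: `L` is
  totally real or CM (the tree's `isTotallyReal_or_isCMField_of_ringHom`, Shimura §18.2 (iv)); if CM it
  contains `0 ≠ α ∈ E₋`, and `Tr_{K/F}(α) = [K:F] · α ≠ 0`.  With §4: under `t = 1` and the Galois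
  hypothesis, **`θ|_{E₋} = 0 ⟺ E ∩ F` totally real** (`forall_trace_algebraMap_eq_zero_iff_isTotallyReal_of_isGalois_left/right`).

## Scope (what is NOT claimed) — the reduction to the components `Kᵢ` in (3)

The print's (3) passes from `EF = K₁ × ⋯ × K_t` to each component and asserts «the trace of `α` over `F`
lies in `E ∩ F`».  Inside ONE component `Kᵢ` the images `Eᵢ`, `Fᵢ` intersect in a field `Lᵢ ⊇ E ∩ F` which
may be LARGER than `E ∩ F` (computed in `End⁰(X)`), and linear disjointness gives `Tr_{Kᵢ/F}(α) =
Tr_{E/Lᵢ}(α) ∈ Lᵢ` only.  For `t ≥ 2` the printed conclusion can fail: `X = Y³` with `End⁰(Y) = E = ℚ(i)`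
(Type 4, `d = 1`, `m = 3`), `F = ℚ(j) ⊂ M₃(E)`, `j = diag(i, i, -i)`: `E ∩ F = ℚ`, `E/ℚ` Galois,
`EF ≅ K₁ × K₂` with `dim_{K₁} V₁ = 2 dim Y`, `dim_{K₂} V₂ = dim Y`, and
`θ(i) = (2 dim Y) · j + (dim Y) · (-j) = (dim Y) · j ≠ 0` (consistently with Criterion (2): `G_div = U_E(V_Y)`
acts on `W_F` through `det_E`, a non-trivial character).  This file therefore proves (3) for ONE FIELD
`K = EF` with `E ∩ F` computed in `K` — which covers the print's case `m = 1` (`d ≥ 2`), where `EF` lies in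
the division algebra `D = End⁰(X)` and is a field — and records, but does not assert, the multi-component
sentence.  Remark (2) is proved as printed.  Abelian varieties do not enter: the junction with the carrier
`weilClassesField` (the algebraic-carrier files `HodgeTheory/WeilClassesFieldCentreInSubfield`,
`…/NoTypeIVFactorOfCentreInTotallyRealField`) is by name only — the tree has no `θ` on `H¹(A(ℂ); ℂ)`.

## References

* [MoonenZarhin1998WeilClasses] B. J. J. Moonen, Yu. G. Zarhin, *Weil classes on abelian varieties*,
  J. reine angew. Math. 496 (1998), 83–92 = arXiv:alg-geom/9612017; the Remarks (1)–(4) after Criterion (2)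
  (arXiv p. 4 = held chunk p0004).
* [Shimura1998] G. Shimura, *Abelian Varieties with Complex Multiplication and Modular Functions*,
  Princeton (1998), §18.2 Lemma (iv) (a subfield of a CM-field is totally real or CM) — the tree's
  `isTotallyReal_or_isCMField_of_ringHom`.
* [Lang2002] S. Lang, *Algebra*, rev. 3rd ed., GTM 211 (2002), Ch. VI §1 Thm. 1.12 and Ch. VIII §1
  (linearly disjoint extensions; `[EF:F] = [E:E∩F]` for `E` Galois) — Mathlib `IntermediateField.LinearDisjoint`.

## Provenance

Lane `lit-hodgefound` (Track 2, Layer A), prover seat `lit-hodgefound-p21` (generation 13), row g13-#1;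
sequel BY NAME of the seat's Moonen–Zarhin 1998 files on the algebraic carrier (`HodgeTheory/WeilClassesField*`).
-/

noncomputable section

namespace Literature.NumberTheory.NumberFields

open NumberField NumberField.ComplexEmbedding NumberField.InfinitePlace
open scoped ComplexConjugate

/-! ### §1 Linearly disjoint `E`, `F` with `K = EF`, `E ∩ F = L`: `Tr_{K/F}|_E = Tr_{E/L}` -/

section LinearDisjoint

variable {L K : Type*} [Field L] [Field K] [Algebra L K] [FiniteDimensional L K]
  {E F : IntermediateField L K}

/-- **Moonen–Zarhin 1998, Remark (3), the trace identity, `E` Galois over `E ∩ F`**: for a finite extension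
`K/L` with intermediate fields `E`, `F` such that `E ∩ F = L` and `EF = K`, if `E/L` is Galois then
`Tr_{K/F}(α) = Tr_{E/L}(α)` for every `α ∈ E` («the trace of `α` (considered as an element of `Kᵢ`) over
`F` lies in `E ∩ F`»; `E` and `F` are linearly disjoint over `L`, Mathlib
`IntermediateField.LinearDisjoint.of_inf_eq_bot` and `LinearDisjoint.trace_algebraMap`).
[cite: MoonenZarhin1998WeilClasses, Remark (3) after Criterion (2) (arXiv p. 4, chunk p0004)] -/
theorem trace_algebraMap_eq_of_isGalois_left [IsGalois L E] (hinf : E ⊓ F = ⊥) (hsup : E ⊔ F = ⊤)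
    (α : E) : Algebra.trace F K (algebraMap E K α) = algebraMap L F (Algebra.trace L E α) :=
  (IntermediateField.LinearDisjoint.of_inf_eq_bot hinf).symm.trace_algebraMap (by rwa [sup_comm]) α

/-- **Moonen–Zarhin 1998, Remark (3), the trace identity, `F` Galois over `E ∩ F`**: as
`trace_algebraMap_eq_of_isGalois_left` with `F/L` Galois instead of `E/L`.
[cite: MoonenZarhin1998WeilClasses, Remark (3) after Criterion (2) (arXiv p. 4, chunk p0004)] -/
theorem trace_algebraMap_eq_of_isGalois_right [IsGalois L F] (hinf : E ⊓ F = ⊥) (hsup : E ⊔ F = ⊤)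
    (α : E) : Algebra.trace F K (algebraMap E K α) = algebraMap L F (Algebra.trace L E α) :=
  (IntermediateField.LinearDisjoint.of_inf_eq_bot (A := F) (B := E) (by rwa [inf_comm])).trace_algebraMap
    (by rwa [sup_comm]) α

/-- **The degree factor of Remark (3) is `1`**: with `E ∩ F = L`, `EF = K` and `E/L` Galois,
`[K : E] = [F : L]` (so the print's `[Kᵢ:E]/[F:E∩F] = 1`; Lang, *Algebra* VI Thm. 1.12).
[cite: MoonenZarhin1998WeilClasses, Remark (3) after Criterion (2) (arXiv p. 4, chunk p0004)] -/
theorem finrank_eq_finrank_of_isGalois_left [IsGalois L E] (hinf : E ⊓ F = ⊥) (hsup : E ⊔ F = ⊤) :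
    Module.finrank E K = Module.finrank L F :=
  (IntermediateField.LinearDisjoint.of_inf_eq_bot hinf).finrank_left_eq_finrank hsup

/-- **The degree factor of Remark (3) is `1`**, `F/L` Galois: `[K : E] = [F : L]`.
[cite: MoonenZarhin1998WeilClasses, Remark (3) after Criterion (2) (arXiv p. 4, chunk p0004)] -/
theorem finrank_eq_finrank_of_isGalois_right [IsGalois L F] (hinf : E ⊓ F = ⊥) (hsup : E ⊔ F = ⊤) :
    Module.finrank E K = Module.finrank L F :=
  (IntermediateField.LinearDisjoint.of_inf_eq_bot (A := F) (B := E) (by rwa [inf_comm])).finrank_right_eq_finrank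
    (by rwa [sup_comm])

/-- **Remark (3), the displayed formula `Tr_{Kᵢ/F}(α) = [Kᵢ:E]/[F:E∩F] · Tr_{E/E∩F}(α)`**, cleared of the
denominator, `E/L` Galois: `[F:L] · Tr_{K/F}(α) = [K:E] · Tr_{E/L}(α)` in `F`.
[cite: MoonenZarhin1998WeilClasses, Remark (3) after Criterion (2) (arXiv p. 4, chunk p0004)] -/
theorem finrank_smul_trace_algebraMap_eq_of_isGalois_left [IsGalois L E] (hinf : E ⊓ F = ⊥)
    (hsup : E ⊔ F = ⊤) (α : E) :
    Module.finrank L F • Algebra.trace F K (algebraMap E K α) =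
      Module.finrank E K • algebraMap L F (Algebra.trace L E α) := by
  rw [trace_algebraMap_eq_of_isGalois_left hinf hsup, finrank_eq_finrank_of_isGalois_left hinf hsup]

/-- **Remark (3), the displayed formula**, `F/L` Galois: `[F:L] · Tr_{K/F}(α) = [K:E] · Tr_{E/L}(α)`.
[cite: MoonenZarhin1998WeilClasses, Remark (3) after Criterion (2) (arXiv p. 4, chunk p0004)] -/
theorem finrank_smul_trace_algebraMap_eq_of_isGalois_right [IsGalois L F] (hinf : E ⊓ F = ⊥)
    (hsup : E ⊔ F = ⊤) (α : E) :
    Module.finrank L F • Algebra.trace F K (algebraMap E K α) =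
      Module.finrank E K • algebraMap L F (Algebra.trace L E α) := by
  rw [trace_algebraMap_eq_of_isGalois_right hinf hsup, finrank_eq_finrank_of_isGalois_right hinf hsup]

end LinearDisjoint

/-! ### §2 An `L`-automorphism negating `α` kills `Tr_{E/L}(α)` -/

section Involution

variable {L S : Type*} [Field L] [CharZero L] [CommRing S] [Algebra L S]

/-- If an `L`-algebra automorphism `σ` of `S` satisfies `σ α = -α`, then `Tr_{S/L}(α) = 0` (the trace is
`σ`-invariant, Mathlib `Algebra.trace_eq_of_algEquiv`; characteristic `0`).  This is the step
«`Tr_{E/E∩F}(α) = 0`» of Remark (3) for `α ∈ E₋` and `σ` the complex conjugation, `E ∩ F ⊆ E₀`.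
[cite: MoonenZarhin1998WeilClasses, Remark (3) after Criterion (2) (arXiv p. 4, chunk p0004)] -/
theorem trace_eq_zero_of_algEquiv_apply_eq_neg (σ : S ≃ₐ[L] S) {α : S} (hα : σ α = -α) :
    Algebra.trace L S α = 0 := by
  have h := Algebra.trace_eq_of_algEquiv σ α
  rw [hα, map_neg] at h
  have h2 : (2 : L) * Algebra.trace L S α = 0 := by linear_combination -h
  exact (mul_eq_zero.mp h2).resolve_left two_ne_zero

variable {K : Type*} [Field K] [Algebra L K] [FiniteDimensional L K] {E F : IntermediateField L K}

/-- **Remark (3) in abstract form, `E` Galois over `E ∩ F`**: `E ∩ F = L`, `EF = K`, `E/L` Galois, and `σ`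
an `L`-automorphism of `E` with `σ α = -α` ⟹ `Tr_{K/F}(α) = 0`.
[cite: MoonenZarhin1998WeilClasses, Remark (3) after Criterion (2) (arXiv p. 4, chunk p0004)] -/
theorem trace_algebraMap_eq_zero_of_isGalois_left [IsGalois L E] (hinf : E ⊓ F = ⊥) (hsup : E ⊔ F = ⊤)
    (σ : E ≃ₐ[L] E) {α : E} (hα : σ α = -α) : Algebra.trace F K (algebraMap E K α) = 0 := by
  rw [trace_algebraMap_eq_of_isGalois_left hinf hsup, trace_eq_zero_of_algEquiv_apply_eq_neg σ hα,
    map_zero]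

/-- **Remark (3) in abstract form, `F` Galois over `E ∩ F`**: `E ∩ F = L`, `EF = K`, `F/L` Galois, `σ` an
`L`-automorphism of `E` with `σ α = -α` ⟹ `Tr_{K/F}(α) = 0`.
[cite: MoonenZarhin1998WeilClasses, Remark (3) after Criterion (2) (arXiv p. 4, chunk p0004)] -/
theorem trace_algebraMap_eq_zero_of_isGalois_right [IsGalois L F] (hinf : E ⊓ F = ⊥) (hsup : E ⊔ F = ⊤)
    (σ : E ≃ₐ[L] E) {α : E} (hα : σ α = -α) : Algebra.trace F K (algebraMap E K α) = 0 := by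
  rw [trace_algebraMap_eq_of_isGalois_right hinf hsup, trace_eq_zero_of_algEquiv_apply_eq_neg σ hα,
    map_zero]

end Involution

/-! ### §3 The CM dictionary: `E ∩ F ⊆ E₀` ⟺ `E ∩ F` totally real; `Tr_{E/L}(E₋) = 0` -/

section CM

variable {L E : Type*} [Field L] [NumberField L] [Field E] [NumberField E] [IsCMField E] [Algebra L E]

omit [NumberField L] in
/-- If `L` is totally real then the complex conjugation of the CM field `E ⊇ L` fixes `L` pointwise
(read along any complex embedding `φ` of `E`: `φ|_L` is real). «`E ∩ F` is a totally real subfield of `E`,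
i.e., `E ∩ F ⊆ E₀`.» [cite: MoonenZarhin1998WeilClasses, Remark (2) after Criterion (2) (arXiv p. 4, chunk p0004)] -/
theorem complexConj_algebraMap_eq_of_isTotallyReal [IsTotallyReal L] (x : L) :
    IsCMField.complexConj E (algebraMap L E x) = algebraMap L E x := by
  obtain ⟨φ⟩ := (inferInstance : Nonempty (E →+* ℂ))
  apply φ.injective
  rw [IsCMField.complexEmbedding_complexConj]
  have hψ : ComplexEmbedding.IsReal (φ.comp (algebraMap L E)) :=
    IsTotallyReal.complexEmbedding_isReal _
  have h := RingHom.congr_fun (ComplexEmbedding.isReal_iff.mp hψ) x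
  simpa only [ComplexEmbedding.conjugate_coe_eq, RingHom.coe_comp, Function.comp_apply] using h

/-- Conversely, if the complex conjugation of the CM field `E` fixes the subfield `L` pointwise then `L` is
totally real (every complex embedding `ψ` of `L` extends to `E`, and `conj ∘ ψ = ψ`).  «i.e.» of Remark (2).
[cite: MoonenZarhin1998WeilClasses, Remark (2) after Criterion (2) (arXiv p. 4, chunk p0004)] -/
theorem isTotallyReal_of_forall_complexConj_algebraMap_eq
    (h : ∀ x : L, IsCMField.complexConj E (algebraMap L E x) = algebraMap L E x) : IsTotallyReal L := by
  refine isTotallyReal_of_forall_isReal fun ψ ↦ ?_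
  letI : Algebra L ℂ := ψ.toAlgebra
  let φ : E →ₐ[L] ℂ := IsAlgClosed.lift
  have hφ : ∀ x : L, φ (algebraMap L E x) = ψ x := fun x ↦ φ.commutes x
  rw [ComplexEmbedding.isReal_iff]
  ext x
  have h1 : φ (IsCMField.complexConj E (algebraMap L E x)) = conj (φ (algebraMap L E x)) :=
    IsCMField.complexEmbedding_complexConj E φ.toRingHom (algebraMap L E x)
  rw [ComplexEmbedding.conjugate_coe_eq, ← hφ, ← h1, h x]

/-- **`E ∩ F` is totally real iff `E ∩ F ⊆ E₀`** (the «i.e.» of Remark (2)): for a number field `L` inside a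
CM field `E`, `L` is totally real iff the complex conjugation of `E` fixes `L` pointwise.
[cite: MoonenZarhin1998WeilClasses, Remark (2) after Criterion (2) (arXiv p. 4, chunk p0004)] -/
theorem isTotallyReal_iff_forall_complexConj_algebraMap_eq :
    IsTotallyReal L ↔ ∀ x : L, IsCMField.complexConj E (algebraMap L E x) = algebraMap L E x :=
  ⟨fun _ x ↦ complexConj_algebraMap_eq_of_isTotallyReal x, isTotallyReal_of_forall_complexConj_algebraMap_eq⟩

/-- An embedding of CM fields commutes with the complex conjugations (Shimura §18.2: read along a complex
embedding of the larger field).  Used in Remark (2): a CM subfield of `E` «must contain totally imaginary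
elements `0 ≠ α ∈ E₋`». [cite: Shimura1998, §18.2 Lemma (i)–(iv)]
[cite: MoonenZarhin1998WeilClasses, Remark (2) after Criterion (2) (arXiv p. 4, chunk p0004)] -/
theorem algebraMap_complexConj [IsCMField L] (y : L) :
    algebraMap L E (IsCMField.complexConj L y) = IsCMField.complexConj E (algebraMap L E y) := by
  obtain ⟨φ⟩ := (inferInstance : Nonempty (E →+* ℂ))
  apply φ.injective
  rw [IsCMField.complexEmbedding_complexConj, ← RingHom.comp_apply, IsCMField.complexEmbedding_complexConj,
    RingHom.comp_apply]

/-- A CM subfield `L` of the CM field `E` contains a non-zero totally imaginary element of `E`: there is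
`z ∈ L`, `z ≠ 0`, with `\overline{z} = -z` in `E` («it must contain totally imaginary elements `0 ≠ α ∈ E₋`»).
[cite: MoonenZarhin1998WeilClasses, Remark (2) after Criterion (2) (arXiv p. 4, chunk p0004)] -/
theorem exists_ne_zero_complexConj_algebraMap_eq_neg [IsCMField L] :
    ∃ z : L, z ≠ 0 ∧ IsCMField.complexConj E (algebraMap L E z) = -algebraMap L E z := by
  obtain ⟨y, hy⟩ : ∃ y : L, IsCMField.complexConj L y ≠ y := by
    by_contra hall
    exact IsCMField.complexConj_ne_one L (AlgEquiv.ext fun y ↦ not_not.mp (not_exists.mp hall y))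
  refine ⟨y - IsCMField.complexConj L y, sub_ne_zero.mpr (Ne.symm hy), ?_⟩
  rw [map_sub, map_sub, ← algebraMap_complexConj, ← algebraMap_complexConj,
    IsCMField.complexConj_apply_apply, neg_sub]

/-- **`Tr_{E/L}(α) = 0` for `α ∈ E₋` when `L ⊆ E₀`** (Remark (3): «`Tr_{E/E∩F}(α) = 0`»): if the complex
conjugation of the CM field `E` fixes `L` pointwise, it is an `L`-automorphism negating `α`.
[cite: MoonenZarhin1998WeilClasses, Remark (3) after Criterion (2) (arXiv p. 4, chunk p0004)] -/
theorem trace_eq_zero_of_complexConj_apply_eq_neg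
    (hL : ∀ x : L, IsCMField.complexConj E (algebraMap L E x) = algebraMap L E x) {α : E}
    (hα : IsCMField.complexConj E α = -α) : Algebra.trace L E α = 0 :=
  trace_eq_zero_of_algEquiv_apply_eq_neg
    (AlgEquiv.ofRingEquiv (f := (IsCMField.complexConj E).toRingEquiv) hL) hα

end CM

/-! ### §4 Remark (3) for `K = EF` a field -/

section RemarkThree

variable {L K : Type*} [Field L] [NumberField L] [Field K] [NumberField K] [Algebra L K]
  {E F : IntermediateField L K} [IsCMField E]

/-- **Moonen–Zarhin 1998, Remark (3), `E` Galois over `E ∩ F`, for ONE field `K = EF`**: let `K ⊇ L` be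
number fields, `E, F` intermediate fields with `E ∩ F = L`, `EF = K`, `E` a CM field Galois over `L` and
`L` totally real («`E ∩ F` is totally real»). Then `Tr_{K/F}(α) = 0` for every `α ∈ E` with `ᾱ = -α`
(«`θ(α) = dim · Tr_{K/F}(α)`, `Tr_{K/F}(α) = … · Tr_{E/E∩F}(α) = 0`»).  Scope: the multi-component sentence
of the print (`EF = K₁ × ⋯ × K_t`, `t ≥ 2`) is NOT asserted — see the module docstring.
[cite: MoonenZarhin1998WeilClasses, Remark (3) after Criterion (2) (arXiv p. 4, chunk p0004)] -/
theorem trace_algebraMap_eq_zero_of_isCMField_of_isGalois_left [IsGalois L E] [IsTotallyReal L]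
    (hinf : E ⊓ F = ⊥) (hsup : E ⊔ F = ⊤) {α : E} (hα : IsCMField.complexConj E α = -α) :
    Algebra.trace F K (algebraMap E K α) = 0 := by
  rw [trace_algebraMap_eq_of_isGalois_left hinf hsup,
    trace_eq_zero_of_complexConj_apply_eq_neg (fun x ↦ complexConj_algebraMap_eq_of_isTotallyReal x) hα,
    map_zero]

/-- **Moonen–Zarhin 1998, Remark (3), `F` Galois over `E ∩ F`, for ONE field `K = EF`**: as
`trace_algebraMap_eq_zero_of_isCMField_of_isGalois_left` with `F/L` Galois («if either `E` or `F` is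
Galois over `E ∩ F`»). [cite: MoonenZarhin1998WeilClasses, Remark (3) after Criterion (2) (arXiv p. 4, chunk p0004)] -/
theorem trace_algebraMap_eq_zero_of_isCMField_of_isGalois_right [IsGalois L F] [IsTotallyReal L]
    (hinf : E ⊓ F = ⊥) (hsup : E ⊔ F = ⊤) {α : E} (hα : IsCMField.complexConj E α = -α) :
    Algebra.trace F K (algebraMap E K α) = 0 := by
  rw [trace_algebraMap_eq_of_isGalois_right hinf hsup,
    trace_eq_zero_of_complexConj_apply_eq_neg (fun x ↦ complexConj_algebraMap_eq_of_isTotallyReal x) hα,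
    map_zero]

end RemarkThree

/-! ### §5 Remark (2): `θ|_{E₋} = 0` forces `E ∩ F` totally real -/

section RemarkTwo

variable {L : Type} {K : Type*} [Field L] [NumberField L] [Field K] [NumberField K] [Algebra L K]
  {E F : IntermediateField L K}

/-- **A non-zero `α ∈ (E ∩ F) ∩ E₋` has non-zero trace over `F`** («which then obviously have a non-zero
trace over `F`»): for `z ∈ L`, `z ≠ 0`, `Tr_{K/F}(z) = [K:F] · z ≠ 0`.
[cite: MoonenZarhin1998WeilClasses, Remark (2) after Criterion (2) (arXiv p. 4, chunk p0004)] -/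
theorem trace_algebraMap_algebraMap_ne_zero {z : L} (hz : z ≠ 0) :
    Algebra.trace F K (algebraMap E K (algebraMap L E z)) ≠ 0 := by
  have hEK : algebraMap E K (algebraMap L E z) = algebraMap F K (algebraMap L F z) := by
    rw [← IsScalarTower.algebraMap_apply, ← IsScalarTower.algebraMap_apply]
  rw [hEK, Algebra.trace_algebraMap]
  refine smul_ne_zero Module.finrank_pos.ne' ?_
  exact (map_ne_zero_iff _ (algebraMap L F).injective).mpr hz

variable [IsCMField E]

/-- **Moonen–Zarhin 1998, Remark (2)**: let `L → E → K` and `L → F → K` be towers of number fields (`E, F`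
intermediate fields of `K/L`; in the print `L = E ∩ F`, `K = Kᵢ`) with `E` a CM field. If `Tr_{K/F}(α) = 0`
for every `α ∈ E₋ = {α ∈ E | ᾱ = -α}` («the map `θ` is zero»), then `L` is totally real («`E ∩ F ⊆ E₀`»).
Printed proof: `L` is totally real or CM (a subfield of a CM field, the tree's
`isTotallyReal_or_isCMField_of_ringHom`); if CM it contains `0 ≠ α ∈ E₋`
(`exists_ne_zero_complexConj_algebraMap_eq_neg`), whose trace over `F` is `[K:F] · α ≠ 0`.
[cite: MoonenZarhin1998WeilClasses, Remark (2) after Criterion (2) (arXiv p. 4, chunk p0004)]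
[cite: Shimura1998, §18.2 Lemma (iv)] -/
theorem isTotallyReal_of_forall_trace_algebraMap_eq_zero
    (h : ∀ α : E, IsCMField.complexConj E α = -α → Algebra.trace F K (algebraMap E K α) = 0) :
    IsTotallyReal L := by
  rcases isTotallyReal_or_isCMField_of_ringHom (algebraMap L E) (Or.inr ‹IsCMField E›) with hL | hL
  · exact hL
  · exfalso
    obtain ⟨z, hz0, hz⟩ := exists_ne_zero_complexConj_algebraMap_eq_neg (L := L) (E := E)
    exact trace_algebraMap_algebraMap_ne_zero (F := F) hz0 (h _ hz)

/-- **Remark (2), the «i.e.» form**: under the hypothesis of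
`isTotallyReal_of_forall_trace_algebraMap_eq_zero`, the complex conjugation of `E` fixes `L` pointwise
(`E ∩ F ⊆ E₀`). [cite: MoonenZarhin1998WeilClasses, Remark (2) after Criterion (2) (arXiv p. 4, chunk p0004)] -/
theorem forall_complexConj_algebraMap_eq_of_forall_trace_algebraMap_eq_zero
    (h : ∀ α : E, IsCMField.complexConj E α = -α → Algebra.trace F K (algebraMap E K α) = 0) (x : L) :
    IsCMField.complexConj E (algebraMap L E x) = algebraMap L E x :=
  haveI := isTotallyReal_of_forall_trace_algebraMap_eq_zero h
  complexConj_algebraMap_eq_of_isTotallyReal x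

/-- **Remark (2), contrapositive**: if `E ∩ F = L` is not totally real there is `0 ≠ α ∈ E₋`, coming from
`L`, with `Tr_{K/F}(α) ≠ 0` — «the converse of (2) does not hold in general» is the print's Remark (4), not
formalised. [cite: MoonenZarhin1998WeilClasses, Remark (2) after Criterion (2) (arXiv p. 4, chunk p0004)] -/
theorem exists_trace_algebraMap_ne_zero_of_not_isTotallyReal (hL : ¬ IsTotallyReal L) :
    ∃ z : L, z ≠ 0 ∧ IsCMField.complexConj E (algebraMap L E z) = -algebraMap L E z ∧
      Algebra.trace F K (algebraMap E K (algebraMap L E z)) ≠ 0 := by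
  haveI : IsCMField L :=
    (isTotallyReal_or_isCMField_of_ringHom (algebraMap L E) (Or.inr ‹IsCMField E›)).resolve_left hL
  obtain ⟨z, hz0, hz⟩ := exists_ne_zero_complexConj_algebraMap_eq_neg (L := L) (E := E)
  exact ⟨z, hz0, hz, trace_algebraMap_algebraMap_ne_zero hz0⟩

/-- **Remarks (2) + (3) combined, `E` Galois over `E ∩ F`, `K = EF` a field**: `θ|_{E₋} = 0`, i.e.
`Tr_{K/F}(α) = 0` for all `α ∈ E₋`, iff `E ∩ F = L` is totally real.
[cite: MoonenZarhin1998WeilClasses, Remarks (2)–(3) after Criterion (2) (arXiv p. 4, chunk p0004)] -/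
theorem forall_trace_algebraMap_eq_zero_iff_isTotallyReal_of_isGalois_left [IsGalois L E]
    (hinf : E ⊓ F = ⊥) (hsup : E ⊔ F = ⊤) :
    (∀ α : E, IsCMField.complexConj E α = -α → Algebra.trace F K (algebraMap E K α) = 0) ↔
      IsTotallyReal L :=
  ⟨isTotallyReal_of_forall_trace_algebraMap_eq_zero, fun _ _ hα ↦
    trace_algebraMap_eq_zero_of_isCMField_of_isGalois_left hinf hsup hα⟩

/-- **Remarks (2) + (3) combined, `F` Galois over `E ∩ F`, `K = EF` a field**: `Tr_{K/F}(α) = 0` for all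
`α ∈ E₋` iff `E ∩ F = L` is totally real.
[cite: MoonenZarhin1998WeilClasses, Remarks (2)–(3) after Criterion (2) (arXiv p. 4, chunk p0004)] -/
theorem forall_trace_algebraMap_eq_zero_iff_isTotallyReal_of_isGalois_right [IsGalois L F]
    (hinf : E ⊓ F = ⊥) (hsup : E ⊔ F = ⊤) :
    (∀ α : E, IsCMField.complexConj E α = -α → Algebra.trace F K (algebraMap E K α) = 0) ↔
      IsTotallyReal L :=
  ⟨isTotallyReal_of_forall_trace_algebraMap_eq_zero, fun _ _ hα ↦
    trace_algebraMap_eq_zero_of_isCMField_of_isGalois_right hinf hsup hα⟩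

end RemarkTwo

end Literature.NumberTheory.NumberFields
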